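/-
Copyright: the b2b-balaban cell (near-miss cell 7), T⁴-continuum fan-out; row NE7b ROUND-2 swarm, seat
t4-ne7b-formalise-leaf-05 gen 2 (row S6g′ binding of `t4/b2b-balaban-t4-ne7b-p1/LEAVES-NE7b.md`, owner's ruling R-OWNER-22-12 (2)).
Released under the licence of the surrounding project.
-/
import Mathlib
import Literature.MathematicalPhysics.QuantumFieldTheory.Balaban1983to89.T4BranchingRecordsGas

/-!
# History joins, part 1: ADDRESSES and the SAME-STEP CLUSTERS of a shape tree (row S6g′, the binding's tree surgery)

Summits-side support leaf of the T⁴-continuum cell (rung (B)+1 on a FINITE torus only; NOT infinite volume, NOT the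
mass gap, NOT the Clay statement; NOT a proof of the spine estimate NE7b).  Row NE7b, route «COUNT»; row S6g′
«MASS-BASED SIBLING COUNT», the BINDING of the generic layer (c) (`HistorySiblingSymmetry` ∕ `…Orbits` ∕ `…Canon`) to
the ordered shape tree.  [folklore] structural recursion over the lineage's own carrier `Gen ε`; nothing is quoted from
print, nothing printed is asserted, no `[cite:]` tag, no `Prop` fact of Bałaban's.

WHY.  The generic layer counts the configurations of ONE JOIN: finitely many PARTS around a HOST, equal-shape parts
sharing their placement space.  On a genealogy `G : Gen ε` (here `ε` is the SHAPE alphabet — the member's tagged tree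
enters through `relabel (shape ∘ sh)`, so equal-shape parts are EQUAL sub-structures) a join is a maximal cluster of
binary mergers of one step `t`, its parts the sub-structures hanging off the cluster, its host the part holding
`Gen.root`.  Tags being irrelevant, a placement is indexed by ADDRESSES: the path (`List Bool`) from the top of `G` to
a birth; the births of a part at path `a` have the addresses `a ++ r`, `r` ranging over the part's OWN addresses — so
equal parts have equal relative address sets and the relative placement `P ∘ (a ++ ·)` lives in one space for all of
them.  This file is the tree surgery: addresses, clusters, cluster roots, and the four decompositions the count needs
(addresses, birth sums, the root, the partner ages — the last being the «tournament identity»: along the binary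
mergers of a cluster every part except the oldest is the younger side exactly once).

WHAT.  §1 `gsize`, `bsum` (+ `bsum_relabel`).  §2 `baddr`, `rootAddr`, `rootAddr_mem_baddr`.  §3
**`clusterParts st t G`** (paths relative to `G`), `gsize_le_of_mem_clusterParts`, **`mem_baddr_iff_clusterParts`**
(addresses decompose), **`eq_of_append_eq`** (unique decomposition: part paths are pairwise non-prefix),
**`bsum_eq_sum_clusterParts`**, **`exists_root_part`** ∕ `rootStep_le_of_mem_clusterParts` (the host),
**`partnerAges_add_eq_sum_clusterParts`** (tournament identity), `gsize_lt_of_mem_jparts`.  The cluster ROOTS (= the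
joins of `G`, with paths) and their decomposition are part 1b `HistoryJoinsRoots`.

HONEST SCOPE.  Pure tree surgery; no zones, no counts (part 2 `HistoryJoinsCount`).  NE7b NOT proved.  HONEST DEPENDENCY
(cell): continuum YM on T⁴ ⇐ BetaPertH ∧ nine spine estimates (0/9 proved); BetaPertH ⇐ (D1) ∧ (D4) ∧ CAP+tail.  This
file changes none of it.
-/

open Finset
open Literature.MathematicalPhysics.QuantumFieldTheory.Balaban1983to89
open T4PersistenceDictionary T4PartnerMultiplicity T4BranchingRecordsGas

namespace Summit.QuantumFields.BalabanUV.T4Continuum.HistoryJoins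

variable {ε δ : Type*}

/-! ## §1 Size and birth sums (multiplicity-correct on a shape tree) -/

/-- number of nodes [folklore] -/
def gsize : Gen ε → ℕ
  | Gen.born _ _ => 1
  | Gen.renew G _ _ => gsize G + 1
  | Gen.merge X Y _ => gsize X + gsize Y + 1

/-- `1 ≤ gsize` [folklore] -/
theorem one_le_gsize : ∀ G : Gen ε, 1 ≤ gsize G
  | Gen.born _ _ => le_rfl
  | Gen.renew _ _ _ => Nat.le_add_left _ _
  | Gen.merge _ _ _ => Nat.le_add_left _ _

/-- **BIRTH SUM WITH MULTIPLICITY**: `Σ_births f(label)` along the tree (on a shape tree `births` as a finset would merge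
equal shapes; this sum does not). [folklore] -/
def bsum (f : ε → ℝ) : Gen ε → ℝ
  | Gen.born b _ => f b
  | Gen.renew G _ _ => bsum f G
  | Gen.merge X Y _ => bsum f X + bsum f Y

/-- nonnegativity [folklore] -/
theorem bsum_nonneg {f : ε → ℝ} (hf : ∀ b, 0 ≤ f b) : ∀ G : Gen ε, 0 ≤ bsum f G
  | Gen.born b _ => hf b
  | Gen.renew G _ _ => bsum_nonneg hf G
  | Gen.merge X Y _ => add_nonneg (bsum_nonneg hf X) (bsum_nonneg hf Y)

/-- the birth sum through a relabelling [folklore] -/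
theorem bsum_relabel (g : ε → δ) (f : δ → ℝ) : ∀ G : Gen ε, bsum f (relabel g G) = bsum (f ∘ g) G
  | Gen.born _ _ => rfl
  | Gen.renew G _ _ => bsum_relabel g f G
  | Gen.merge X Y _ => by simp only [relabel_merge, bsum, bsum_relabel g f X, bsum_relabel g f Y]

/-! ## §2 Addresses -/

/-- **THE ADDRESSES OF THE BIRTHS**: the path from the top of `G` to the birth (`false` = first partner, `true` = second;
renewals are transparent). [folklore] -/
def baddr : Gen ε → Finset (List Bool)
  | Gen.born _ _ => {[]}
  | Gen.renew G _ _ => baddr G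
  | Gen.merge X Y _ => (baddr X).image (List.cons false) ∪ (baddr Y).image (List.cons true)

/-- the address of the root birth (ties towards the first partner, as `Gen.root`) [folklore] -/
def rootAddr : Gen ε → List Bool
  | Gen.born _ _ => []
  | Gen.renew G _ _ => rootAddr G
  | Gen.merge X Y _ => if X.rootStep ≤ Y.rootStep then false :: rootAddr X else true :: rootAddr Y

/-- the root address is a birth address [folklore] -/
theorem rootAddr_mem_baddr : ∀ G : Gen ε, rootAddr G ∈ baddr G
  | Gen.born _ _ => by simp [rootAddr, baddr]
  | Gen.renew G _ _ => rootAddr_mem_baddr G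
  | Gen.merge X Y _ => by
      simp only [rootAddr, baddr, mem_union, mem_image]
      split_ifs
      · exact Or.inl ⟨_, rootAddr_mem_baddr X, rfl⟩
      · exact Or.inr ⟨_, rootAddr_mem_baddr Y, rfl⟩

/-- addresses survive relabelling [folklore] -/
theorem baddr_relabel (g : ε → δ) : ∀ G : Gen ε, baddr (relabel g G) = baddr G
  | Gen.born _ _ => rfl
  | Gen.renew G _ _ => baddr_relabel g G
  | Gen.merge X Y _ => by simp only [relabel_merge, baddr, baddr_relabel g X, baddr_relabel g Y]

/-! ## §3 Same-step clusters and their parts -/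

section Clusters

variable (st : ε → ℕ)

/-- **THE PARTS OF THE STEP-`t` CLUSTER AT THE TOP OF `G`**, with their paths relative to `G`: a merger of step `t`
dissolves into the parts of its two partners; anything else is ONE part. [folklore] -/
def clusterParts (t : ℕ) : Gen ε → List (List Bool × Gen ε)
  | Gen.merge X Y e =>
      if st e = t then
        (clusterParts t X).map (fun q => (false :: q.1, q.2)) ++ (clusterParts t Y).map (fun q => (true :: q.1, q.2))
      else [([], Gen.merge X Y e)]
  | G => [([], G)]

/-- a bare birth is one part [folklore] -/
@[simp] theorem clusterParts_born (t : ℕ) (b : ε) (j : ℕ) : clusterParts st t (Gen.born b j) = [([], Gen.born b j)] :=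
  rfl

/-- a renewal is one part (renewals close clusters) [folklore] -/
@[simp] theorem clusterParts_renew (t : ℕ) (G : Gen ε) (e : ε) (h : ℕ) :
    clusterParts st t (Gen.renew G e h) = [([], Gen.renew G e h)] := rfl

/-- a merger of step `t` dissolves into its partners' parts [folklore] -/
theorem clusterParts_merge_of_eq {t : ℕ} {X Y : Gen ε} {e : ε} (he : st e = t) :
    clusterParts st t (Gen.merge X Y e) =
      (clusterParts st t X).map (fun q => (false :: q.1, q.2)) ++
        (clusterParts st t Y).map (fun q => (true :: q.1, q.2)) := by
  simp [clusterParts, he]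

/-- a merger of another step is one part [folklore] -/
theorem clusterParts_merge_of_ne {t : ℕ} {X Y : Gen ε} {e : ε} (he : st e ≠ t) :
    clusterParts st t (Gen.merge X Y e) = [([], Gen.merge X Y e)] := by
  simp [clusterParts, he]

/-- there is always at least one part [folklore] -/
theorem one_le_length_clusterParts (t : ℕ) : ∀ G : Gen ε, 1 ≤ (clusterParts st t G).length
  | Gen.born b j => by simp
  | Gen.renew G e h => by simp
  | Gen.merge X Y e => by
      by_cases he : st e = t
      · rw [clusterParts_merge_of_eq st he, List.length_append, List.length_map, List.length_map]
        have := one_le_length_clusterParts t X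
        omega
      · rw [clusterParts_merge_of_ne st he]; simp

/-- **THE PARTS OF THE TOP JOIN** of a merger: its step-`(st e)` cluster parts. [folklore] -/
def jparts : Gen ε → List (List Bool × Gen ε)
  | Gen.merge X Y e => clusterParts st (st e) (Gen.merge X Y e)
  | _ => []

/-- the parts of the top join of a merger [folklore] -/
theorem jparts_merge (X Y : Gen ε) (e : ε) :
    jparts st (Gen.merge X Y e) =
      (clusterParts st (st e) X).map (fun q => (false :: q.1, q.2)) ++
        (clusterParts st (st e) Y).map (fun q => (true :: q.1, q.2)) := by
  simp [jparts, clusterParts_merge_of_eq st rfl]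

/-- parts are at most as big as the whole [folklore] -/
theorem gsize_le_of_mem_clusterParts (t : ℕ) : ∀ (G : Gen ε), ∀ q ∈ clusterParts st t G, gsize q.2 ≤ gsize G
  | Gen.born b j, q, hq => by simp at hq; simp [hq]
  | Gen.renew G e h, q, hq => by simp at hq; simp [hq]
  | Gen.merge X Y e, q, hq => by
      by_cases he : st e = t
      · rw [clusterParts_merge_of_eq st he, List.mem_append, List.mem_map, List.mem_map] at hq
        rcases hq with ⟨q', hq', rfl⟩ | ⟨q', hq', rfl⟩
        · have := gsize_le_of_mem_clusterParts t X q' hq'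
          simp only [gsize]; omega
        · have := gsize_le_of_mem_clusterParts t Y q' hq'
          simp only [gsize]; omega
      · rw [clusterParts_merge_of_ne st he, List.mem_singleton] at hq
        simp [hq]

/-- **THE PARTS OF A JOIN ARE STRICTLY SMALLER** than the join. [folklore] -/
theorem gsize_lt_of_mem_jparts : ∀ (G : Gen ε), ∀ q ∈ jparts st G, gsize q.2 < gsize G
  | Gen.born b j, q, hq => by simp [jparts] at hq
  | Gen.renew G e h, q, hq => by simp [jparts] at hq
  | Gen.merge X Y e, q, hq => by
      rw [jparts_merge, List.mem_append, List.mem_map, List.mem_map] at hq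
      rcases hq with ⟨q', hq', rfl⟩ | ⟨q', hq', rfl⟩
      · have := gsize_le_of_mem_clusterParts st (st e) X q' hq'
        simp only [gsize]; omega
      · have := gsize_le_of_mem_clusterParts st (st e) Y q' hq'
        simp only [gsize]; omega

/-- **ADDRESSES DECOMPOSE ALONG THE PARTS**: an address of `G` is a part's path followed by an address of that part.
[folklore] -/
theorem mem_baddr_iff_clusterParts (t : ℕ) :
    ∀ (G : Gen ε) (a : List Bool), a ∈ baddr G ↔ ∃ q ∈ clusterParts st t G, ∃ r ∈ baddr q.2, a = q.1 ++ r
  | Gen.born b j, a => by simp [baddr]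
  | Gen.renew G e h, a => by simp [baddr]
  | Gen.merge X Y e, a => by
      by_cases he : st e = t
      · rw [clusterParts_merge_of_eq st he]
        simp only [baddr, mem_union, mem_image, List.mem_append, List.mem_map]
        constructor
        · rintro (⟨r, hr, rfl⟩ | ⟨r, hr, rfl⟩)
          · obtain ⟨q, hq, r', hr', rfl⟩ := (mem_baddr_iff_clusterParts t X r).1 hr
            exact ⟨(false :: q.1, q.2), Or.inl ⟨q, hq, rfl⟩, r', hr', rfl⟩
          · obtain ⟨q, hq, r', hr', rfl⟩ := (mem_baddr_iff_clusterParts t Y r).1 hr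
            exact ⟨(true :: q.1, q.2), Or.inr ⟨q, hq, rfl⟩, r', hr', rfl⟩
        · rintro ⟨q, (⟨q', hq', rfl⟩ | ⟨q', hq', rfl⟩), r, hr, rfl⟩
          · exact Or.inl ⟨q'.1 ++ r, (mem_baddr_iff_clusterParts t X _).2 ⟨q', hq', r, hr, rfl⟩, rfl⟩
          · exact Or.inr ⟨q'.1 ++ r, (mem_baddr_iff_clusterParts t Y _).2 ⟨q', hq', r, hr, rfl⟩, rfl⟩
      · rw [clusterParts_merge_of_ne st he]
        simp

/-- **UNIQUE DECOMPOSITION**: the paths of two parts are never prefixes of one another, so `q.1 ++ r = q'.1 ++ r'`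
forces `q = q'` and `r = r'`. [folklore] -/
theorem eq_of_append_eq (t : ℕ) :
    ∀ (G : Gen ε), ∀ q ∈ clusterParts st t G, ∀ q' ∈ clusterParts st t G, ∀ r r' : List Bool,
      q.1 ++ r = q'.1 ++ r' → q = q' ∧ r = r'
  | Gen.born b j, q, hq, q', hq', r, r', h => by
      simp at hq hq'; subst hq; subst hq'; simpa using h
  | Gen.renew G e hh, q, hq, q', hq', r, r', h => by
      simp at hq hq'; subst hq; subst hq'; simpa using h
  | Gen.merge X Y e, q, hq, q', hq', r, r', h => by
      by_cases he : st e = t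
      · rw [clusterParts_merge_of_eq st he, List.mem_append, List.mem_map, List.mem_map] at hq hq'
        rcases hq with ⟨p, hp, rfl⟩ | ⟨p, hp, rfl⟩ <;> rcases hq' with ⟨p', hp', rfl⟩ | ⟨p', hp', rfl⟩ <;>
          simp only [List.cons_append, List.cons.injEq] at h
        · obtain ⟨h1, h2⟩ := eq_of_append_eq t X p hp p' hp' r r' h.2
          exact ⟨by rw [h1], h2⟩
        · simp at h
        · simp at h
        · obtain ⟨h1, h2⟩ := eq_of_append_eq t Y p hp p' hp' r r' h.2
          exact ⟨by rw [h1], h2⟩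
      · rw [clusterParts_merge_of_ne st he, List.mem_singleton] at hq hq'
        subst hq; subst hq'; simpa using h

/-- **BIRTH SUMS DECOMPOSE ALONG THE PARTS.** [folklore] -/
theorem bsum_eq_sum_clusterParts (f : ε → ℝ) (t : ℕ) :
    ∀ G : Gen ε, bsum f G = ((clusterParts st t G).map fun q => bsum f q.2).sum
  | Gen.born b j => by simp [bsum]
  | Gen.renew G e h => by simp [bsum]
  | Gen.merge X Y e => by
      by_cases he : st e = t
      · rw [clusterParts_merge_of_eq st he, List.map_append, List.sum_append, List.map_map, List.map_map]
        simp only [bsum, bsum_eq_sum_clusterParts f t X, bsum_eq_sum_clusterParts f t Y]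
        rfl
      · rw [clusterParts_merge_of_ne st he]
        simp [bsum]

/-- **THE HOST**: some part holds the root — its path followed by its own root address is the root address of `G`, and
its root step is the root step of `G`. [folklore] -/
theorem exists_root_part (t : ℕ) :
    ∀ G : Gen ε, ∃ q ∈ clusterParts st t G, rootAddr G = q.1 ++ rootAddr q.2 ∧ G.rootStep = q.2.rootStep
  | Gen.born b j => ⟨_, List.mem_singleton.2 rfl, by simp, rfl⟩
  | Gen.renew G e h => ⟨_, List.mem_singleton.2 rfl, by simp, rfl⟩
  | Gen.merge X Y e => by
      by_cases he : st e = t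
      · rw [clusterParts_merge_of_eq st he]
        simp only [rootAddr, Gen.rootStep, List.mem_append, List.mem_map]
        by_cases hle : X.rootStep ≤ Y.rootStep
        · obtain ⟨q, hq, h1, h2⟩ := exists_root_part t X
          refine ⟨(false :: q.1, q.2), Or.inl ⟨q, hq, rfl⟩, ?_, ?_⟩
          · simp [hle, h1]
          · rw [min_eq_left hle, h2]
        · obtain ⟨q, hq, h1, h2⟩ := exists_root_part t Y
          refine ⟨(true :: q.1, q.2), Or.inr ⟨q, hq, rfl⟩, ?_, ?_⟩
          · simp [hle, h1]
          · rw [min_eq_right (le_of_not_ge hle), h2]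
      · rw [clusterParts_merge_of_ne st he]
        exact ⟨_, List.mem_singleton.2 rfl, by simp, rfl⟩

/-- the host is the oldest part [folklore] -/
theorem rootStep_le_of_mem_clusterParts (t : ℕ) :
    ∀ (G : Gen ε), ∀ q ∈ clusterParts st t G, G.rootStep ≤ q.2.rootStep
  | Gen.born b j, q, hq => by simp at hq; simp [hq]
  | Gen.renew G e h, q, hq => by simp at hq; simp [hq]
  | Gen.merge X Y e, q, hq => by
      by_cases he : st e = t
      · rw [clusterParts_merge_of_eq st he, List.mem_append, List.mem_map, List.mem_map] at hq
        simp only [Gen.rootStep]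
        rcases hq with ⟨q', hq', rfl⟩ | ⟨q', hq', rfl⟩
        · exact (min_le_left _ _).trans (rootStep_le_of_mem_clusterParts t X q' hq')
        · exact (min_le_right _ _).trans (rootStep_le_of_mem_clusterParts t Y q' hq')
      · rw [clusterParts_merge_of_ne st he, List.mem_singleton] at hq
        simp [hq]

/-- **THE TOURNAMENT IDENTITY**: along the binary mergers of the step-`t` cluster every part except the oldest is the
younger side exactly once — `partnerAges G + (t + 1 − rootStep G) = Σ_parts (partnerAges part + (t + 1 − rootStep part))`.
[folklore] -/
theorem partnerAges_add_eq_sum_clusterParts (t : ℕ) :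
    ∀ G : Gen ε, partnerAges st G + (t + 1 - G.rootStep) =
      ((clusterParts st t G).map fun q => partnerAges st q.2 + (t + 1 - q.2.rootStep)).sum
  | Gen.born b j => by simp
  | Gen.renew G e h => by simp [Gen.rootStep]
  | Gen.merge X Y e => by
      by_cases he : st e = t
      · rw [clusterParts_merge_of_eq st he, List.map_append, List.sum_append, List.map_map, List.map_map]
        have hX := partnerAges_add_eq_sum_clusterParts t X
        have hY := partnerAges_add_eq_sum_clusterParts t Y
        have hcX : ((clusterParts st t X).map
            ((fun q : List Bool × Gen ε => partnerAges st q.2 + (t + 1 - q.2.rootStep)) ∘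
              fun q => (false :: q.1, q.2))).sum = partnerAges st X + (t + 1 - X.rootStep) := by
          rw [hX]; rfl
        have hcY : ((clusterParts st t Y).map
            ((fun q : List Bool × Gen ε => partnerAges st q.2 + (t + 1 - q.2.rootStep)) ∘
              fun q => (true :: q.1, q.2))).sum = partnerAges st Y + (t + 1 - Y.rootStep) := by
          rw [hY]; rfl
        rw [hcX, hcY, partnerAges_merge, he]
        simp only [Gen.rootStep]
        rcases le_total X.rootStep Y.rootStep with hle | hle
        · rw [max_eq_right hle, min_eq_left hle]; omega
        · rw [max_eq_left hle, min_eq_right hle]; omega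
      · rw [clusterParts_merge_of_ne st he]
        simp

end Clusters

end Summit.QuantumFields.BalabanUV.T4Continuum.HistoryJoins
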